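import Literature.MathematicalPhysics.QuantumLattice.HubbardDressedClusterEnergyFunctional
import Literature.InformationTheory.Entropy.VonNeumannEntropy
import HarnessLib

/-!
# Claim-node predicates for the seam-dressed cluster pressure floors (certificate C3 of the `T > 0` Hubbard family)

Topic `Literature/MathematicalPhysics/QuantumLattice` (namespace = path; family `hubbard`). Part B of the kernel reader for
hubbard-thermal-eng-2's «seam-dressed type-class cluster floor» (HOME/hubbard-thermal-p2/C3-READER-SPEC.md; Part A =
`HubbardDressedCluster{TorusGeometry,EnergyFunctional,…}.lean`, p2). A C3 certificate (CERT-FE.md §hubfe-c3/0) is a RECIPE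
for an explicit trial state — ONE box density `σ = ⊕_s q_s ρ_s` on `[0,a) × [0,b)` and one layer of exact Cayley gates
`u_g` on separated supports `G g` — together with interval-certified numbers `S⁻ ≤ S(σ)`, `E⁺ ≥ E_box(σ, W)`
(`SeamDressed.boxEnergy`, the functional of `HubbardDressedClusterEnergyFunctional.lean`) and the claimed floor
`W0 ≤ (S⁻ − β E⁺)/(ab)`; every evaluation of the recipe (desk: `verify_c3.py`) proves the claim for its own explicit state.
The KERNEL consumes such a certificate through a CLAIM NODE asserting the existence of the witness with exactly the
hypotheses of the pressure-floor theorem of the sequel (`HubbardDressedClusterPressureFloor.lean`, p2):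

* `SeamDressed.Node t t' U a b n S⁻ E⁺` — ∃ (gates `G, u` separated modulo the box lattice, inside `gateRange a b`,
  unitary and particle-number conserving; box state `σ ⪰ 0`, `tr σ = 1`, `[σ, N] = 0`, `Re tr(σN) = n·ab`) with
  `S⁻ ≤ S(σ)` and `boxEnergy … ≤ E⁺` (the two-number form of the JSON `rigorous` block);
* `SeamDressed.FloorNode t t' U a b n β W0` — the same witness with the ONE-number conclusion
  `W0·(ab) ≤ S(σ) − β·boxEnergy …` (the JSON `claim.W0`);
* `SeamDressed.floorNode_of_node` — `Node … S⁻ E⁺ → 0 ≤ β → W0·ab ≤ S⁻ − βE⁺ → FloorNode … β W0` (the arithmetic a cell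
  file discharges by `norm_num`).

The evenness witnesses that `boxEnergy` takes as arguments are derived inside the predicates from particle-number
conservation (`parityAut_eq_self_of_commute_totalNumber`), so a node names only physical hypotheses. Definitions (two
`Prop`-valued predicates) + one lemma; no named fact. The entropy input may alternatively be certified by the kernel from
per-sector data (`SectorMixtureEntropyCheck.lean`, `le_vonNeumannEntropy_of_c3EntropyCheck`).
[cite: KlieschEtAl2014, §II] [cite: Israel1979, Lemma II.3.1]

## Tree / Mathlib search

REUSED: `SeamDressed.boxEnergy`, `SeamDressed.gateRange`, `rectWindow` (`HubbardDressedClusterEnergyFunctional`,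
`…TorusGeometry`), `parityAut_eq_self_of_commute_totalNumber` (`FermionGateDressingLightCone`), `vonNeumannEntropy`.
`lean search 'SeamDressed.*Node|C3Node|FloorNode'`: nothing (2026-08-27).
-/

noncomputable section

namespace Literature.MathematicalPhysics.QuantumLattice

open Matrix Finset HubbardWave0 Literature.Probability.LatticeModels AndersonCluster Literature.InformationTheory.Entropy
open scoped ComplexOrder BigOperators

namespace SeamDressed

/-- **C3 claim node, two-number form.** There are `m` reference gates with supports `G g ⊆ gateRange a b`, separated modulo
the box lattice `aℤ × bℤ`, carrying particle-number-conserving unitaries `u g`, and a box density matrix `σ` on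
`[0,a) × [0,b)` (`σ ⪰ 0`, `tr σ = 1`, `[σ, N] = 0`, `Re tr(σN) = n·ab`) with `S⁻ ≤ S(σ)` and `E_box(σ, W) ≤ E⁺`.
[cite: KlieschEtAl2014, §II] -/
def Node (t t' U : ℝ) (a b : ℕ) [NeZero a] [NeZero b] (n Slo Ehi : ℝ) : Prop :=
  ∃ (m : ℕ) (G : Fin m → Finset (Site 2))
    (hsep : ∀ g g', ∀ x ∈ G g, ∀ x' ∈ G g', ((a : ℤ) ∣ x' 0 - x 0) → ((b : ℤ) ∣ x' 1 - x 1) → g = g' ∧ x = x')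
    (u : ∀ g, FermionOp (G g)) (huN : ∀ g, Commute (totalNumber : FermionOp (G g)) (u g))
    (σ : FermionOp (rectWindow a b)) (hσN : Commute (totalNumber : FermionOp (rectWindow a b)) σ),
    (∀ g, G g ⊆ gateRange a b) ∧ (∀ g, (u g)ᴴ * u g = 1) ∧ σ.PosSemidef ∧ σ.trace = 1 ∧
      (σ * (totalNumber : FermionOp (rectWindow a b))).trace.re = n * (a * b) ∧
      Slo ≤ vonNeumannEntropy σ ∧
      boxEnergy a b G hsep u (fun g => parityAut_eq_self_of_commute_totalNumber (huN g)) σ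
          (parityAut_eq_self_of_commute_totalNumber hσN) t t' U ≤ Ehi

/-- **C3 claim node, one-number (floor) form**: the same witness with `W0·(ab) ≤ S(σ) − β·E_box(σ, W)` — the input of the
Gibbs variational pressure floor `W0 ≤ pressureTT' β t t' U n` of the sequel. [cite: Israel1979, Lemma II.3.1] -/
def FloorNode (t t' U : ℝ) (a b : ℕ) [NeZero a] [NeZero b] (n β W0 : ℝ) : Prop :=
  ∃ (m : ℕ) (G : Fin m → Finset (Site 2))
    (hsep : ∀ g g', ∀ x ∈ G g, ∀ x' ∈ G g', ((a : ℤ) ∣ x' 0 - x 0) → ((b : ℤ) ∣ x' 1 - x 1) → g = g' ∧ x = x')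
    (u : ∀ g, FermionOp (G g)) (huN : ∀ g, Commute (totalNumber : FermionOp (G g)) (u g))
    (σ : FermionOp (rectWindow a b)) (hσN : Commute (totalNumber : FermionOp (rectWindow a b)) σ),
    (∀ g, G g ⊆ gateRange a b) ∧ (∀ g, (u g)ᴴ * u g = 1) ∧ σ.PosSemidef ∧ σ.trace = 1 ∧
      (σ * (totalNumber : FermionOp (rectWindow a b))).trace.re = n * (a * b) ∧
      W0 * (a * b) ≤ vonNeumannEntropy σ -
        β * boxEnergy a b G hsep u (fun g => parityAut_eq_self_of_commute_totalNumber (huN g)) σ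
          (parityAut_eq_self_of_commute_totalNumber hσN) t t' U

/-- **From the two-number node to the floor node**: `S⁻ ≤ S(σ)`, `E_box ≤ E⁺`, `β ≥ 0` and the certified arithmetic
`W0·ab ≤ S⁻ − β E⁺` give `W0·ab ≤ S(σ) − β E_box`. [cite: Israel1979, Lemma II.3.1] -/
theorem floorNode_of_node {t t' U : ℝ} {a b : ℕ} [NeZero a] [NeZero b] {n Slo Ehi β W0 : ℝ}
    (h : Node t t' U a b n Slo Ehi) (hβ : 0 ≤ β) (harith : W0 * (a * b) ≤ Slo - β * Ehi) :
    FloorNode t t' U a b n β W0 := by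
  obtain ⟨m, G, hsep, u, huN, σ, hσN, hG, huU, hσ, hσtr, hσn, hS, hE⟩ := h
  refine ⟨m, G, hsep, u, huN, σ, hσN, hG, huU, hσ, hσtr, hσn, ?_⟩
  have := mul_le_mul_of_nonneg_left hE hβ
  linarith

end SeamDressed

end Literature.MathematicalPhysics.QuantumLattice

end
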